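import Literature.MathematicalPhysics.QuantumLattice.Imbrie2016.TwoSiteSpread

/-!
# Imbrie (2016), Assumption LLA: the two-site local spreads have total square at least 4

CITATION HEADER (lean-in-tree rule 2026-08-18). J. Z. Imbrie, *On many-body localization for quantum spin chains*,
J. Stat. Phys. **163** (2016) 998–1048, doi 10.1007/s10955-016-1508-x, arXiv:1403.7837 [ImbrieJSP2016], eq. (1.1) (local
diagonal operators S^z_i, S^z_{i-1} S^z_i carrying the random fields and bonds), eq. (1.3) (Assumption LLA).

WHAT IS PROVED (a lemma of the audit cell `pub-imbrie`, NOT a statement of the paper; pub-imbrie LLA.md gen-4 G4′(a), constant made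
explicit).  For a real diagonal operator V and an orthonormal pair (u, v), the eigenvalue spread of the compression of V to span(u, v) is
`spr_V² = (V_uu − V_vv)² + 4 V_uv²`; with `V_uu − V_vv = Σ_σ s_V(σ)(u_σ² − v_σ²)` and `V_uv = Σ_σ s_V(σ) u_σ v_σ`.  On a TWO-site box,
for the three local operators V ∈ {Z₁, Z₂, Z₁Z₂}:
* `twoSite_localSpreads_sq_sum` — the Walsh–Parseval identity `Σ_V spr_V² = 4 Σ_σ (u_σ² + v_σ²)² − (|u|² − |v|²)² − 4 ⟨u,v⟩²` (pure algebra);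
* `twoSite_localSpreads_sq_sum_ge_four` — hence for orthonormal u ⊥ v: `Σ_V spr_V² ≥ 4` (Cauchy–Schwarz on the four numbers u_σ² + v_σ², which sum to 2);
* `twoSite_exists_localSpread_sq_ge` — so some local V has `spr_V² ≥ 4/3`, the explicit c₀ of LLA.md G4′(a) (c₀ = 2/√3), sharpening the
  qualitative `twoSite_localSpreads_ne_zero` of the companion file.  In the level-velocity reading (G3): every adjacent eigenpair of an isolated
  two-site cluster is split to first or second order by one of its three local couplings with a margin controlled by 4/3 and the isolation.
  From three sites on no such bound exists (`ThreeSiteSpread`).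

STATUS: elementary real algebra; says NOTHING about whether LLA holds (OPEN, pub-imbrie LLA.md §7). No `sorry`, no new axioms, no new definitions.
-/

namespace Literature.MathematicalPhysics.QuantumLattice.Imbrie2016

open Finset

/-- four reals summing to 2 have squares summing to at least 1 (Cauchy–Schwarz). [cite: ImbrieJSP2016, eq. (1.3)] -/
theorem sum_sq_ge_one_of_sum_eq_two (a b c d : ℝ) (h : a + b + c + d = 2) : 1 ≤ a ^ 2 + b ^ 2 + c ^ 2 + d ^ 2 := by
  nlinarith [sq_nonneg (a - b), sq_nonneg (c - d), sq_nonneg (a + b - c - d)]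

/-- Walsh–Parseval on a 2-site box: the total squared spread of the three local operators Z₁, Z₂, Z₁Z₂ in the plane of (u, v) equals
`4 Σ_σ (u_σ² + v_σ²)² − (Σ u² − Σ v²)² − 4 (Σ u v)²`. [cite: ImbrieJSP2016, eq. (1.1), (1.3)] -/
theorem twoSite_localSpreads_sq_sum (u v : Cfg 2 → ℝ) :
    ((∑ σ, (if σ 0 then (1 : ℝ) else -1) * (u σ ^ 2 - v σ ^ 2)) ^ 2
        + 4 * (∑ σ, (if σ 0 then (1 : ℝ) else -1) * (u σ * v σ)) ^ 2)
      + ((∑ σ, (if σ 1 then (1 : ℝ) else -1) * (u σ ^ 2 - v σ ^ 2)) ^ 2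
        + 4 * (∑ σ, (if σ 1 then (1 : ℝ) else -1) * (u σ * v σ)) ^ 2)
      + ((∑ σ, ((if σ 0 then (1 : ℝ) else -1) * (if σ 1 then (1 : ℝ) else -1)) * (u σ ^ 2 - v σ ^ 2)) ^ 2
        + 4 * (∑ σ, ((if σ 0 then (1 : ℝ) else -1) * (if σ 1 then (1 : ℝ) else -1)) * (u σ * v σ)) ^ 2)
      = 4 * ∑ σ, (u σ ^ 2 + v σ ^ 2) ^ 2 - (∑ σ, u σ ^ 2 - ∑ σ, v σ ^ 2) ^ 2 - 4 * (∑ σ, u σ * v σ) ^ 2 := by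
  simp only [sum_cfg_two, Matrix.cons_val_zero, Matrix.cons_val_one, Bool.false_eq_true, if_true, if_false]
  ring

/-- For an orthonormal pair on a 2-site box the three local squared spreads sum to at least 4. [cite: ImbrieJSP2016, eq. (1.1), (1.3)] -/
theorem twoSite_localSpreads_sq_sum_ge_four (u v : Cfg 2 → ℝ)
    (hu : ∑ σ, u σ ^ 2 = 1) (hv : ∑ σ, v σ ^ 2 = 1) (huv : ∑ σ, u σ * v σ = 0) :
    4 ≤ ((∑ σ, (if σ 0 then (1 : ℝ) else -1) * (u σ ^ 2 - v σ ^ 2)) ^ 2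
        + 4 * (∑ σ, (if σ 0 then (1 : ℝ) else -1) * (u σ * v σ)) ^ 2)
      + ((∑ σ, (if σ 1 then (1 : ℝ) else -1) * (u σ ^ 2 - v σ ^ 2)) ^ 2
        + 4 * (∑ σ, (if σ 1 then (1 : ℝ) else -1) * (u σ * v σ)) ^ 2)
      + ((∑ σ, ((if σ 0 then (1 : ℝ) else -1) * (if σ 1 then (1 : ℝ) else -1)) * (u σ ^ 2 - v σ ^ 2)) ^ 2
        + 4 * (∑ σ, ((if σ 0 then (1 : ℝ) else -1) * (if σ 1 then (1 : ℝ) else -1)) * (u σ * v σ)) ^ 2) := by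
  rw [twoSite_localSpreads_sq_sum, hu, hv, huv]
  have h2 : ∑ σ, (u σ ^ 2 + v σ ^ 2) = 2 := by rw [Finset.sum_add_distrib, hu, hv]; norm_num
  have h1 : 1 ≤ ∑ σ, (u σ ^ 2 + v σ ^ 2) ^ 2 := by
    simp only [sum_cfg_two] at h2 ⊢
    exact sum_sq_ge_one_of_sum_eq_two _ _ _ _ h2
  linarith

/-- Hence some local operator on the 2-site box has squared spread ≥ 4/3 in the plane of (u, v): the explicit constant of
LLA.md gen-4 G4′(a). [cite: ImbrieJSP2016, eq. (1.1), (1.3)] -/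
theorem twoSite_exists_localSpread_sq_ge (u v : Cfg 2 → ℝ)
    (hu : ∑ σ, u σ ^ 2 = 1) (hv : ∑ σ, v σ ^ 2 = 1) (huv : ∑ σ, u σ * v σ = 0) :
    4 / 3 ≤ (∑ σ, (if σ 0 then (1 : ℝ) else -1) * (u σ ^ 2 - v σ ^ 2)) ^ 2
        + 4 * (∑ σ, (if σ 0 then (1 : ℝ) else -1) * (u σ * v σ)) ^ 2 ∨
    4 / 3 ≤ (∑ σ, (if σ 1 then (1 : ℝ) else -1) * (u σ ^ 2 - v σ ^ 2)) ^ 2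
        + 4 * (∑ σ, (if σ 1 then (1 : ℝ) else -1) * (u σ * v σ)) ^ 2 ∨
    4 / 3 ≤ (∑ σ, ((if σ 0 then (1 : ℝ) else -1) * (if σ 1 then (1 : ℝ) else -1)) * (u σ ^ 2 - v σ ^ 2)) ^ 2
        + 4 * (∑ σ, ((if σ 0 then (1 : ℝ) else -1) * (if σ 1 then (1 : ℝ) else -1)) * (u σ * v σ)) ^ 2 := by
  have h := twoSite_localSpreads_sq_sum_ge_four u v hu hv huv
  by_cases h1 : (4 / 3 : ℝ) ≤ (∑ σ, (if σ 0 then (1 : ℝ) else -1) * (u σ ^ 2 - v σ ^ 2)) ^ 2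
      + 4 * (∑ σ, (if σ 0 then (1 : ℝ) else -1) * (u σ * v σ)) ^ 2
  · exact Or.inl h1
  by_cases h2 : (4 / 3 : ℝ) ≤ (∑ σ, (if σ 1 then (1 : ℝ) else -1) * (u σ ^ 2 - v σ ^ 2)) ^ 2
      + 4 * (∑ σ, (if σ 1 then (1 : ℝ) else -1) * (u σ * v σ)) ^ 2
  · exact Or.inr (Or.inl h2)
  exact Or.inr (Or.inr (by linarith))

end Literature.MathematicalPhysics.QuantumLattice.Imbrie2016
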